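import Literature.MathematicalPhysics.QuantumFieldTheory.Balaban1983to89.Node00.CarriersB8Cube

/-!
# NODE 00 — the DENTED cube datum of [Balaban1985Variational] (144)–(153): [Balaban1985RegularSpaces] Sect. F's cube tower with its TOP LEVEL CUT BACK TO
# `□_k ∩ Ω_k`, and Proposition 6's conclusion (1.135)–(1.138) READ ON THAT TOWER (`CubeB8D`, `GaugedBoundB8D` — the `CubeB8` ∕ `GaugedBoundB8` siblings)

[Balaban1985RegularSpaces] = T. Bałaban, *Spaces of regular gauge field configurations on a lattice and gauge fixing conditions*, Commun. Math. Phys. **99**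
(1985) 75–102 ("[6]" below), Sect. F pp. 98–99, (1.131)–(1.138).  [Balaban1985Variational] = T. Bałaban, *The variational problem and background fields in
renormalization group method for lattice gauge theories*, Commun. Math. Phys. **102** (1985) 277–309 ("[15]"), Sect. 3 pp. 300–301, (144)–(153)
(held text `paper:balaban1985-cmp102-variational-background` pp. 24–25, re-read by this seat 2026-08-28).

CITATION HEADER (lean-in-tree rule).  Cell `pub-ymgap` (HUMAN RULING D-0062, YM Track A), DAG node N05 = [6] (with the N07 = [15] lane as consumer), seat
`pub-ymgap-dag-n05-e` generation 30 (FAN-OUT v1.1 §N05 row s3b, Proposition-6 lane; the «(β) ∕ (d1)» piece of this seat's WORD (β), bus 2026-08-28 I.41343, priced by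
dag-n05-c I.41357, consumer GO by dag-n07-e I.41586 — «CONSUMER-SIDE GO … please type `Node00/CarriersB8CubeDented.lean`»).  DEFINITIONS + `rfl` ∕ set-algebra
bookkeeping only; `--kind definition`.  Nothing of [6] or [15] is asserted.

WHAT IS PRINTED.  [6] p. 98–99 build, for a cube `□` with «□ ⊂ Ω_j» (w.l.o.g. `j = k`), the tower `□₀ ⊃ □₁ ⊃ … ⊃ □_k ⊃ □`, `□̃ ⊃ □₀`, «□̃ ⊂ Ω_{k−1}», the cells
`Λ′_j = □_j^{(j)} ∖ □_{j+1}^{(j)}`, `Λ′_k = □_k^{(k)}`, `ℭ_k = ⋃ Λ′_j` (1.131), and prove Proposition 6 ((1.135)–(1.138)) on it — NODE 00's `CubeB8` ∕ `GaugedBoundB8`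
(`Node00/CarriersB8Cube`).  [15] p. 300 takes instead «a cube □ intersecting Ω_j but not Ω_{j+1}» — `□` may stick out of `Ω_j` — builds «the sequence of cubes {□_n}
and the cube □̃» with «dist(□_{n+1}, □_nᶜ) = R₁M₁Lⁿη» (144), «□̃ ⊂ B^{j−1}(Λ_{j−1}) ∪ Bʲ(Λ_j) ⊂ Ω_{j−1}», «for simplicity j = k», and then (p. 301) works with the LOCAL
SEQUENCE `{Ω′_j}` of (148)–(150): «Ω′_j = □_j, j = 0, 1, …, k − 1», the top member cut back to the part of `□_k` inside `Ω_k`, with ITS cells `Λ′_j` and ITS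
averaging operation «R … defined for the sequence {Ω′_j}» (153); [6] Theorem 2 is applied to the pair `U_k, 1` in that sequence's spaces, giving «a unique gauge
transformation u satisfying the restrictions ū_j = 1 on Λ′_j» with «Lʲη|A|, (Lʲη)²|∇A|, (Lʲη)³|∂*∂A|, (Lʲη)³|ΔA| < 9dL²B₁Mε₀ on Ω′_j, j = 0, …, k (152);
R∂*A = 0 (153)».  The only geometric input beyond [6] is that `Ω_k` is «a sum of big blocks» ([6] (1.3)–(1.4) p. 77: «Ω_j = Bʲ(Ω_j^{(j)})»), so that
`□_k ∩ Ω_k` is again a union of `k`-blocks and the level-`k` averages over it make sense.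

WHAT THIS MODULE DEFINES (interface agreed on the bus: dag-n05-c PRICE (d2) I.41357 «keep `CubeB8`'s field NAMES and add the dent as ONE extra field», dag-n07-e GO
I.41586 points (i)–(iv)).
* §1 `CubeB8D d L K Ω` — `CubeB8`'s fields `k, a, M, ρ, one_le_k, k_le, L_le_ρ, ρ_le_M, big, L_le_dM, tcube_sub` VERBATIM, the field `box_sub : □ ⊆ Ω_k` of the
  pure datum DROPPED (the cube may stick out of `Ω_k`; `□ ⊆ □̃ ⊆ Ω_{k−1}` remains, `CubeB8D.box_subset_omega_pred`), and ONE new field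
  `blocks : ∀ x y, blockMap (Lᵏ) x = blockMap (Lᵏ) y → x ∈ Ω k → y ∈ Ω k` — «Ω_k = Bᵏ(Ω_k^{(k)})», [6] (1.3) at the top level, in the letters of
  `B8Eq134Admissible.blockSat_of_bigCubes14` (so every `BigCubes14` ∕ `Admissible134` family supplies it by that lemma at `j := k`).  Same-named
  abbreviations as `CubeB8`: **`sq`** — THE DENTED TOWER `Ω′_j`: `□_j` for `j ≠ k` (n05-a's `cubeFam false`), `□_k ∩ Ω_k` at `j = k`; **`lamS`** — ITS CELLS
  (level-`j` labels): [6]'s `Λ′_j` (n05-c's `cubeLam`) for `j + 1 < k`, at `j = k − 1` the `(k−1)`-blocks of `□_{k−1}` NOT lying in `□_k ∩ Ω_k` (so the dent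
  `□_k ∖ Ω_k` is covered at level `k − 1`), at `j = k` the `k`-blocks of `□_k` lying in `Ω_k`; `inTop` (the `k`-block over a label lies in `Ω_k`); and
  `vfix ∕ axial ∕ dprime ∕ fixed ∕ expo` with the SAME bodies as `CubeB8`'s (the axial gauge `v` of p. 98 ∕ [15] p. 300 is the level-`k` iterated axial gauge on
  all of `□̃^{(k)}` in both papers; the masked exponent `expo` reads the dented tower).  Bookkeeping: `sq_top`, `sq_of_lt`, `sq_zero`, `sq_of_gt`, `sq_subset_cube`,
  `sq_top_subset_omega`, `sq_subset_omega_pred`, `box_subset_omega_pred`, `sq_succ_subset`, `sq_eq_cubeFam_of_subset` (empty dent = the pure tower), `sq_top_blockSat` (the dented top is a union of `k`-blocks),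
  `mem_sq_top_of_inTop`, `lamS_of_succ_lt`, `mem_lamS_pred_iff`, `mem_lamS_top_iff`, `lamS_of_gt`, `lamS_top_subset`, and the pure-datum embedding
  `CubeB8.toDented` (a `CubeB8` cube over a level-`k`-block-saturated family IS a dented datum; its dented top is `□_k ∩ Ω_k`, which print's pure case does not
  assume equal to `□_k` either — p. 99 «□_k ⊂ Ω_{k−1}, □_j ⊂ Ω_j, j < k»).
* §2 **`GaugedBoundB8D L η U₀ c r`** — `GaugedBoundB8`'s twelve clauses VERBATIM with `c.sq ∕ c.lamS` the dented tower ∕ cells: the gauge `u` unitary, `= 1` off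
  `□₀`, (1.29) «ū_j = 1 on Λ′_j» w.r.t. the DENTED cells (dag-n07-e (iii): «THE conjunct the K0 road needs», print p. 301 «ū_j = 1 on Λ′_j»), the Landau gauge of
  record (1.138)∕(153) w.r.t. the dented cells, (1.135)₂ ∧ (1.136)₁ on the sides touching `Ω′_j` WITH PRINT'S LEVEL WEIGHTS `r·(Lʲη)⁻¹` (so a bond of the dent,
  touching `Ω′_{k−1} = □_{k−1}` but not `Ω′_k`, is weighed at level `k − 1` — dag-n07-e (ii) «LOCATED-DENT-WEIGHTS … harmless»), `w = v⁻¹u` unitary with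
  `U₀^{w⁻¹} = U₁` on `□̃`, (1.136)₂–₄ in the scaled sup norms over the dented tower, and (1.137)'s identity `Q_k(ηA) = log Ū₀′ᵏ` on those bonds of `□^{(k)}` BOTH
  of whose `k`-blocks lie in `Ω_k` (the level-`k` averages of the sequence `{Ω′_j}` live on `Λ′_k ⊆ Ω_k^{(k)}`).  `gaugedBoundB8D_intro` ∕ `gaugedBoundB8D_iff`
  (anonymous constructor ∕ `Iff.rfl`), `CubeB8D.inAk` (index truncation `K ↦ c.k`, as `CubeB8.inAk`).
* §3 non-vacuity: `CubeB8D.ofUniv` ∕ `CubeB8D.nonempty_of_univ` (ambient `Ω_k = Ω_{k−1} = T`).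

HONEST SCOPE ∕ LOCATED.  (a) DEFINITIONS and set bookkeeping only; NO estimate; [6] Proposition 6 ∕ Theorem 2 and [15] (152)–(153) on the dented tower are NOT
asserted here — they are the sequel kernel files priced on the bus ((d2) dag-n05-c: the dented `TDomains′` member + the (1.59)♭ target + chart twins; (d3) this seat:
the γ re-assembly over `CubeB8D`; the N07 push-down door: dag-n07-e).  (b) The dent is read as [15] (148)–(150) read by three seats (this seat g28 WORD (β) I.41343,
dag-n05-c I.41357, dag-n07-e I.41443 ∕ I.41586): ONLY the top member is cut (`Ω′_k = □_k ∩ Ω_k`), lower members are [6]'s `□_j`; (144)'s collar widths are [6]'s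
(`ρ = R₁M₁`); [15]'s «size 2MLʲη» of `□` is a choice of the side `M` (a field), not a law.  (c) «`□` meets `Ω_k`» and «`□` misses `Ω_{k+1}`» are NOT fields: the
first only makes the datum interesting (an empty dented top is allowed and harmless), the second is print's w.l.o.g. «drop the domains Ω_{j′}, j′ > j» (`k_le` +
`CubeB8D.inAk`), exactly as in `CubeB8`.  (d) The block law is stated at the fine `Lᵏ`-block granularity ((1.3)'s «Ω_j = Bʲ(Ω_j^{(j)})»); a consumer whose chart
wants the big `M₁Lᵏ`-blocks of (1.4) carries `BigCubes14` itself and gets `blocks` from `blockSat_of_bigCubes14` (dag-n05-c's (d2) `bigBlocks` law is a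
hypothesis ON `Ω`, not on the cube).  (e) (1.137) is restricted to the bonds of `□^{(k)}` over `Ω_k`; its inequalities and the uniqueness of `u` stay un-folded, as
in `GaugedBoundB8`.  (f) `ℤᵈ` carriers (`T_η ↦ ℤᵈ`), as the whole N05 lineage; the torus reading is dag-n07-e's cover files (`Node00/TorusCover*`).  N05 ∕ N07 NOT
discharged; counts unmoved; one finite 𝕋⁴ programme at fixed ε, Bałaban as printed — NOT continuum ∕ ℝ⁴ ∕ OS ∕ mass gap ∕ Clay.  No `sorry`, no `axiom`, no
`instance`, no `notation`.
-/

noncomputable section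

namespace Literature.MathematicalPhysics.QuantumFieldTheory.Balaban1983to89.Node00

open MatrixLog (mlog)
open Literature.MathematicalPhysics.QuantumLattice (blockMap)
open B7Prop1Explicit B7Prop2Explicit B7Prop1Local B8Ineq130
open B8LeafModelZd3 (mlogCfg)
open B8Ineq132 (InAk covDerivFwd Under)
open B8Ineq133 (cutFixed)
open B8Eq115GaugeFixing (localGauge)
open B8Eq119TwistedAxial (Restr129)
open B8Eq184Proof (cfgExp)
open B8Eq140Level (SideTouches)
open B8Eq138LandauZd (IsLandau138W logCfg covLap)
open B8Eq146AExpansion (iEta plaqCovDeriv)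
open B8Eq143PlaqExpansion (pdiv)
open B7Prop4GeneralLevels (logCovIter)
open B8ScaledSupNorm (bondNorm msup)
open B8Eq131Cubes (box cube tcube tLo tHi ctr bLo bHi sqLo sqHi inLo inHi flm under_flm box_subset_cube_top cube_anti cube_subset_tcube)
open B8Eq131CubesAdmissible (cubeFam cubeFam_false_of_le cubeFam_false_zero cubeFam_of_lt)
open B8CubeMemberZd (cubeLam cubeLamS cube_blockSat)

/-! ## §1. The dented cube datum `CubeB8D`, its tower `sq` and its cells `lamS` -/

section Cube

variable {d : ℕ}

/-- **A CUBE `□` OF [15] p. 300 («a cube □ intersecting Ω_j but not Ω_{j+1}») inside an ambient admissible family `{Ω_j}_{j ≤ K}`** — the DENTED sibling of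
`CubeB8`: the scale index `k` (print's `j`, «for simplicity of notations we assume that j = k»), the lower corner `a` and the side `M` of `□^{(k)} = [a, a + M)ᵈ`, the
collar width `ρ = R₁M₁` ((144): «dist(□_{n+1}, □_nᶜ) = R₁M₁Lⁿη») with `L ≤ ρ ≤ M`, the (1.130)-step condition `11d < M` and `L ≤ dM` (as `CubeB8`), «□̃ ⊂ Ω_{k−1}»
(`tcube_sub`, (144) «□̃ ⊂ B^{j−1}(Λ_{j−1}) ∪ Bʲ(Λ_j) ⊂ Ω_{j−1}»), and the ONE new law `blocks`: `Ω_k` is a union of `k`-blocks of the fine lattice ([6] (1.3)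
«Ω_j = Bʲ(Ω_j^{(j)})», in `B8Eq134Admissible.blockSat_of_bigCubes14`'s letters).  The pure datum's «□ ⊂ Ω_k» is NOT required.
[cite: Balaban1985Variational, p.300 («Let us take a cube □ intersecting Ω_j but not Ω_{j+1}»), (144) p.300; Balaban1985RegularSpaces, p.98, (1.3) p.77] -/
structure CubeB8D (d L K : ℕ) (Ω : ℕ → Set (B7Prop1Explicit.Site d)) : Type where
  /-- scale index of `□` (print's `j`, renamed `k`) -/
  k : ℕ
  /-- lower corner of `□^{(k)} = [a, a + M)ᵈ` -/
  a : B7Prop1Explicit.Site d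
  /-- side `M` of `□^{(k)}` -/
  M : ℕ
  /-- `ρ = R₁M₁`, the width of the collars `□_j \ □_{j+1}` -/
  ρ : ℕ
  one_le_k : 1 ≤ k
  k_le : k ≤ K
  L_le_ρ : L ≤ ρ
  ρ_le_M : ρ ≤ M
  big : 11 * d < M
  L_le_dM : L ≤ d * M
  /-- «□̃ ⊂ Ω_{k−1}» ((144)) -/
  tcube_sub : tcube L a M ρ k ⊆ Ω (k - 1)
  /-- «Ω_k = Bᵏ(Ω_k^{(k)})»: `Ω_k` is saturated for the `Lᵏ`-blocks of the fine lattice ((1.3)) -/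
  blocks : ∀ ⦃x y : B7Prop1Explicit.Site d⦄, blockMap (L ^ k) x = blockMap (L ^ k) y → x ∈ Ω k → y ∈ Ω k

namespace CubeB8D

variable {L K : ℕ} {Ω : ℕ → Set (B7Prop1Explicit.Site d)} (c : CubeB8D d L K Ω)

/-- **THE DENTED TOWER `{Ω′_j}_{j ≤ k}` of [15] (148)–(150)**: `Ω′_j = □_j` for `j ≠ k` (n05-a's `cubeFam false`, `Ω′₀ = □₀`), `Ω′_k = □_k ∩ Ω_k`.
[cite: Balaban1985Variational, (148)–(150) p.301 («Ω′_j = □_j, j = 0, 1, …, k − 1»); Balaban1985RegularSpaces, (1.131) p.99] -/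
def sq : ℕ → Set (B7Prop1Explicit.Site d) := fun j => cubeFam false L c.a c.M c.ρ c.k j ∩ {x | j = c.k → x ∈ Ω c.k}

/-- «the `k`-block over the level-`k` label `x` lies in `Ω_k`» (`Bᵏ(x) ⊂ Ω_k`). [cite: Balaban1985RegularSpaces, (1.3)/(1.6) p.77 («Ω_j = Bʲ(Ω_j^{(j)})»)] -/
def inTop (x : B7Prop1Explicit.Site d) : Prop := ∀ z, Under L c.k x z → z ∈ Ω c.k

/-- **THE CELLS `Λ′_j` OF THE DENTED TOWER** (level-`j` labels; [6] (1.5)∕(1.131) for the sequence `{Ω′_j}`): for `j + 1 < k` print's `Λ′_j = □_j^{(j)} ∖ □_{j+1}^{(j)}`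
(n05-c's `cubeLam`); at `j = k − 1` the labels of `□_{k−1}^{(k−1)}` whose block does NOT lie in `Ω′_k = □_k ∩ Ω_k` (i.e. not both in `□_k^{(k−1)}` and over `Ω_k`); at
`j = k` the labels of `□_k^{(k)}` whose `k`-block lies in `Ω_k`; empty above `k`.  Written as ONE comprehension (the case split is by the guards `j = k`, `j + 1 = k`).
[cite: Balaban1985Variational, (148) p.301, (152) p.301 («ū_j = 1 on Λ′_j»); Balaban1985RegularSpaces, (1.131) p.99, (1.5) p.77] -/
def lamS : ℕ → Set (B7Prop1Explicit.Site d) := fun j =>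
  if j ≤ c.k then
    {z | InBox (sqLo L c.a c.ρ c.k j) (sqHi L c.a c.M c.ρ c.k j) z ∧ (j = c.k → ∀ x, Under L j z x → x ∈ Ω c.k) ∧
      (j < c.k → ¬ (InBox (inLo L c.a c.ρ c.k j) (inHi L c.a c.M c.ρ c.k j) z ∧ (j + 1 = c.k → ∀ x, Under L j z x → x ∈ Ω c.k)))}
  else ∅

variable {𝔸 : Type*} [CStarAlgebra 𝔸]

/-- The gauge transformation `v : U₀ ↦ U₀′` of [6] p. 98 ∕ [15] p. 300 («U′_k satisfies the generalized axial gauge conditions on □̃^{(k)}»): n05-a's `localGauge`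
on `□̃` at depth `k` with centre `y` — SAME body as `CubeB8.vfix`. [cite: Balaban1985RegularSpaces, p.98; Balaban1985Variational, p.300 (sentence before (145))] -/
abbrev vfix (U₀ : B7Prop1Explicit.Site d → Fin d → 𝔸ˣ) : B7Prop1Explicit.Site d → 𝔸ˣ := localGauge L (tLo c.a c.ρ) (tHi c.a c.M c.ρ) U₀ c.k (ctr c.a c.M)

/-- `U₀′ = U₀^{v}`. [cite: Balaban1985RegularSpaces, p.98, (1.129) p.98] -/
abbrev axial (U₀ : B7Prop1Explicit.Site d → Fin d → 𝔸ˣ) : B7Prop1Explicit.Site d → Fin d → 𝔸ˣ := gaugeAct (c.vfix U₀) U₀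

/-- `U₀″` := `U₀′` on `□̃`, `1` outside ([6] p. 99; [15] (149) «V″»). [cite: Balaban1985RegularSpaces, p.99; Balaban1985Variational, (149) p.301] -/
abbrev dprime (U₀ : B7Prop1Explicit.Site d → Fin d → 𝔸ˣ) : B7Prop1Explicit.Site d → Fin d → 𝔸ˣ := cutFixed L (tLo c.a c.ρ) (tHi c.a c.M c.ρ) U₀ c.k (ctr c.a c.M)

/-- `U₁ = U₀″^{u⁻¹}`. [cite: Balaban1985RegularSpaces, p.99] -/
abbrev fixed (U₀ : B7Prop1Explicit.Site d → Fin d → 𝔸ˣ) (u : B7Prop1Explicit.Site d → 𝔸ˣ) : B7Prop1Explicit.Site d → Fin d → 𝔸ˣ := gaugeAct u⁻¹ (c.dprime U₀)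

/-- The exponent `A = (1/iη) log U₁` of (1.135)∕(152), masked to the sides touching the DENTED tower. [cite: Balaban1985RegularSpaces, (1.135) p.99; Balaban1985Variational, (152) p.301] -/
abbrev expo (η : ℝ) (U₀ : B7Prop1Explicit.Site d → Fin d → 𝔸ˣ) (u : B7Prop1Explicit.Site d → 𝔸ˣ) : B7Prop1Explicit.Site d → Fin d → 𝔸 :=
  mlogCfg c.k η c.sq (c.fixed U₀ u)

/-! ### The tower: readings -/

/-- `Ω′_k = □_k ∩ Ω_k`. [cite: Balaban1985Variational, (148)–(150) p.301] -/
theorem sq_top : c.sq c.k = cube L c.a c.M c.ρ c.k c.k ∩ Ω c.k := by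
  ext x
  simp [CubeB8D.sq, cubeFam_false_of_le L c.a c.M c.ρ (le_refl c.k)]

/-- `Ω′_j = □_j` for `j < k`. [cite: Balaban1985Variational, (150) p.301 («Ω′_j = □_j, j = 0, 1, …, k − 1»)] -/
theorem sq_of_lt {j : ℕ} (hj : j < c.k) : c.sq j = cube L c.a c.M c.ρ c.k j := by
  ext x
  simp [sq, cubeFam_false_of_le L c.a c.M c.ρ hj.le, Nat.ne_of_lt hj]

/-- `Ω′₀ = □₀` (`k ≥ 1`). [cite: Balaban1985Variational, (150) p.301; Balaban1985RegularSpaces, p.98] -/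
theorem sq_zero : c.sq 0 = cube L c.a c.M c.ρ c.k 0 := c.sq_of_lt c.one_le_k

/-- `Ω′_j = ∅` above `k` (the tower has `k + 1` members). [cite: Balaban1985Variational, (150) p.301 (dictionary); Balaban1985RegularSpaces, (1.3) p.77] -/
theorem sq_of_gt {j : ℕ} (hj : c.k < j) : c.sq j = ∅ := by
  ext x
  simp [sq, cubeFam_of_lt false L c.a c.M c.ρ hj]

/-- `Ω′_j ⊆ □_j`: the dented tower lies inside [6]'s pure tower, level by level. [cite: Balaban1985Variational, (148)–(150) p.301] -/
theorem sq_subset_cubeFam (j : ℕ) : c.sq j ⊆ cubeFam false L c.a c.M c.ρ c.k j := fun _ hx => hx.1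

/-- `Ω′_j ⊆ □_j` for `j ≤ k`, in `cube` letters. [cite: Balaban1985Variational, (148)–(150) p.301] -/
theorem sq_subset_cube {j : ℕ} (hj : j ≤ c.k) : c.sq j ⊆ cube L c.a c.M c.ρ c.k j := by
  rw [← cubeFam_false_of_le L c.a c.M c.ρ hj]; exact c.sq_subset_cubeFam j

/-- `Ω′_k ⊆ Ω_k` — the point of the dent. [cite: Balaban1985Variational, (150) p.301] -/
theorem sq_top_subset_omega : c.sq c.k ⊆ Ω c.k := fun _ hx => hx.2 rfl

/-- `Ω′_j ⊆ □̃ ⊆ Ω_{k−1}` for every `j ≤ k` (`L ≥ 2`): every member of the dented tower lies in `Ω_{k−1}`. [cite: Balaban1985Variational, (144) p.300 («□̃ ⊂ … ⊂ Ω_{j−1}»); Balaban1985RegularSpaces, p.98] -/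
theorem sq_subset_omega_pred (hL : 2 ≤ L) {j : ℕ} (hj : j ≤ c.k) : c.sq j ⊆ Ω (c.k - 1) :=
  ((c.sq_subset_cube hj).trans (cube_subset_tcube hL (le_trans (le_trans one_le_two hL) c.L_le_ρ) hj)).trans c.tcube_sub

/-- `□ ⊆ Ω_{k−1}` (`L ≥ 2`). [cite: Balaban1985Variational, (144) p.300] -/
theorem box_subset_omega_pred (hL : 2 ≤ L) : box L c.a c.M c.k ⊆ Ω (c.k - 1) :=
  ((box_subset_cube_top L c.a c.M c.ρ c.k).trans (cube_subset_tcube hL (le_trans (le_trans one_le_two hL) c.L_le_ρ) le_rfl)).trans c.tcube_sub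

/-- The dented tower is nested: `Ω′_{j+1} ⊆ Ω′_j`. [cite: Balaban1985RegularSpaces, (1.3) p.77; Balaban1985Variational, (144) p.300] -/
theorem sq_succ_subset (j : ℕ) : c.sq (j + 1) ⊆ c.sq j := by
  intro x hx
  by_cases hj : j + 1 ≤ c.k
  · have hjk : j ≠ c.k := by omega
    refine ⟨?_, fun h => (hjk h).elim⟩
    rw [cubeFam_false_of_le L c.a c.M c.ρ (by omega)]
    have hx1 := hx.1
    rw [cubeFam_false_of_le L c.a c.M c.ρ hj] at hx1
    exact cube_anti (Nat.le_succ j) hj hx1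
  · rw [c.sq_of_gt (by omega)] at hx
    exact hx.elim

/-- **EMPTY DENT = [6]'s PURE TOWER**: if `□_k ⊆ Ω_k` the dented tower IS n05-a's `cubeFam false` at every level (the (d2)∕(d3) twins then specialise back to the
pure files). [cite: Balaban1985RegularSpaces, (1.131) p.99; Balaban1985Variational, (150) p.301] -/
theorem sq_eq_cubeFam_of_subset (h : cube L c.a c.M c.ρ c.k c.k ⊆ Ω c.k) (j : ℕ) : c.sq j = cubeFam false L c.a c.M c.ρ c.k j := by
  ext x
  refine ⟨fun hx => hx.1, fun hx => ⟨hx, fun hj => ?_⟩⟩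
  subst hj
  rw [cubeFam_false_of_le L c.a c.M c.ρ le_rfl] at hx
  exact h hx

/-- The two spellings of the `Lᵏ`-block map of (1.3)∕(1.6): n05-a's `flm L k` = `blockMap (Lᵏ)` (bookkeeping). [cite: Balaban1985RegularSpaces, (1.6) p.77 («Bʲ(x)»)] -/
theorem flm_eq_blockMap (L k : ℕ) (x : B7Prop1Explicit.Site d) : flm L k x = blockMap (L ^ k) x := by
  funext i; simp [flm, blockMap, Nat.cast_pow]

/-- The floor map inverts `Under`: `z ∈ Bᵏ(x) ⇒ ⌊z∕Lᵏ⌋ = x` (private plumbing, as in `B8CubeMemberZd`). [folklore] -/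
private theorem flm_eq_of_under {L : ℕ} (hL : 1 ≤ L) {m : ℕ} {x z : B7Prop1Explicit.Site d} (hz : Under L m x z) : flm L m z = x := by
  funext i
  obtain ⟨h1, h2⟩ := hz i
  have hL0 : (0 : ℤ) < (L : ℤ) := by exact_mod_cast hL
  have hpos : (0 : ℤ) < (L : ℤ) ^ m := pow_pos hL0 m
  simp only [flm]
  have hlo : x i ≤ z i / (L : ℤ) ^ m := Int.le_ediv_of_mul_le hpos (by linarith)
  have hhi : z i / (L : ℤ) ^ m < x i + 1 := Int.ediv_lt_of_lt_mul hpos (by linarith)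
  omega

/-- The block law in the tower's `Under`∕`flm` spelling: a site of `Ω_k` carries its whole `k`-block into `Ω_k`. [cite: Balaban1985RegularSpaces, (1.3) p.77] -/
theorem blocks_under (hL : 1 ≤ L) {x x' : B7Prop1Explicit.Site d} (hx : x ∈ Ω c.k) (hx' : Under L c.k (flm L c.k x) x') : x' ∈ Ω c.k := by
  refine c.blocks ?_ hx
  rw [← flm_eq_blockMap, ← flm_eq_blockMap, flm_eq_of_under hL hx']

/-- A site of `Ω_k` has its `k`-block in `Ω_k`: `inTop (flm L k x)`. [cite: Balaban1985RegularSpaces, (1.3) p.77] -/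
theorem inTop_flm_of_mem (hL : 1 ≤ L) {x : B7Prop1Explicit.Site d} (hx : x ∈ Ω c.k) : c.inTop (flm L c.k x) :=
  fun _ hz => c.blocks_under hL hx hz

/-- **THE DENTED TOP IS A UNION OF `k`-BLOCKS**: `Ω′_k = □_k ∩ Ω_k` is saturated for the `Lᵏ`-blocks (n05-c's `cube_blockSat` and the field `blocks`).
[cite: Balaban1985RegularSpaces, (1.3) p.77, p.98 («for every j the cube □_j is a sum of the big blocks of the lattice T_{L^{−j}}»)] -/
theorem sq_top_blockSat (hL : 1 ≤ L) {x x' : B7Prop1Explicit.Site d} (hx : x ∈ c.sq c.k) (hx' : Under L c.k (flm L c.k x) x') : x' ∈ c.sq c.k := by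
  rw [sq_top] at hx ⊢
  exact ⟨cube_blockSat hL c.a c.M c.ρ c.k c.k hx.1 hx', c.blocks_under hL hx.2 hx'⟩

/-- A fine site under a level-`k` label of `□_k^{(k)}` whose block lies in `Ω_k` is in the dented top. [cite: Balaban1985Variational, (148) p.301] -/
theorem mem_sq_top_of_inTop (hL : 1 ≤ L) {z x : B7Prop1Explicit.Site d} (hz : InBox (sqLo L c.a c.ρ c.k c.k) (sqHi L c.a c.M c.ρ c.k c.k) z)
    (hin : c.inTop z) (hx : Under L c.k z x) : x ∈ c.sq c.k := by
  rw [sq_top]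
  exact ⟨(B8Eq131Cubes.mem_cube_iff hL).2 ⟨z, hz, hx⟩, hin x hx⟩

/-! ### The cells: readings -/

/-- Below the dent the cells are [6]'s: `Λ′_j = □_j^{(j)} ∖ □_{j+1}^{(j)}` for `j + 1 < k` (n05-c's `cubeLam`). [cite: Balaban1985RegularSpaces, (1.131) p.99] -/
theorem lamS_of_succ_lt {j : ℕ} (hj : j + 1 < c.k) : c.lamS j = cubeLam L c.a c.M c.ρ c.k j := by
  ext z
  have h1 : j ≤ c.k := by omega
  have h2 : j ≠ c.k := by omega
  have h3 : j + 1 ≠ c.k := by omega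
  have h4 : j < c.k := by omega
  simp [lamS, cubeLam, h1, h2, h3, h4]

/-- The level-`(k−1)` cells: labels of `□_{k−1}^{(k−1)}` whose block is not a block of `Ω′_k = □_k ∩ Ω_k` — [6]'s `Λ′_{k−1}` PLUS the `(k−1)`-blocks of the dent.
[cite: Balaban1985Variational, (148) p.301; Balaban1985RegularSpaces, (1.131) p.99] -/
theorem mem_lamS_pred_iff (z : B7Prop1Explicit.Site d) :
    z ∈ c.lamS (c.k - 1) ↔ InBox (sqLo L c.a c.ρ c.k (c.k - 1)) (sqHi L c.a c.M c.ρ c.k (c.k - 1)) z ∧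
      ¬ (InBox (inLo L c.a c.ρ c.k (c.k - 1)) (inHi L c.a c.M c.ρ c.k (c.k - 1)) z ∧ ∀ x, Under L (c.k - 1) z x → x ∈ Ω c.k) := by
  have hk := c.one_le_k
  have h1 : c.k - 1 ≤ c.k := Nat.sub_le _ _
  have h2 : c.k - 1 ≠ c.k := by omega
  have h3 : c.k - 1 < c.k := by omega
  have h4 : c.k - 1 + 1 = c.k := by omega
  simp [lamS, h1, h2, h3, h4]

/-- The level-`k` cells: labels of `□_k^{(k)}` whose `k`-block lies in `Ω_k` (= `(Ω′_k)^{(k)}`). [cite: Balaban1985Variational, (148) p.301; Balaban1985RegularSpaces, (1.131) p.99 («Λ′_k = □_k^{(k)}»)] -/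
theorem mem_lamS_top_iff (z : B7Prop1Explicit.Site d) :
    z ∈ c.lamS c.k ↔ InBox (sqLo L c.a c.ρ c.k c.k) (sqHi L c.a c.M c.ρ c.k c.k) z ∧ c.inTop z := by
  simp [lamS, inTop]

/-- No cells above `k` (`Λ′_j`, `j = 0, …, k`). [cite: Balaban1985Variational, (148) p.301 (dictionary); Balaban1985RegularSpaces, (1.131) p.99] -/
theorem lamS_of_gt {j : ℕ} (hj : c.k < j) : c.lamS j = ∅ := by
  have : ¬ j ≤ c.k := by omega
  simp [lamS, this]

/-- The level-`k` cells lie in [6]'s `Λ′_k = □_k^{(k)}` (the pure truncation `cubeLamS … k k`). [cite: Balaban1985RegularSpaces, (1.131) p.99] -/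
theorem lamS_top_subset : c.lamS c.k ⊆ cubeLamS L c.a c.M c.ρ c.k c.k c.k := by
  intro z hz
  rw [mem_lamS_top_iff] at hz
  simp [cubeLamS, hz.1]

/-- A fine site under a level-`k` cell lies in the dented top `Ω′_k` («Bᵏ(Λ′_k) ⊂ Ω′_k», law `htower` at the top). [cite: Balaban1985RegularSpaces, (1.5)–(1.6) p.77] -/
theorem under_lamS_top_subset (hL : 1 ≤ L) {z x : B7Prop1Explicit.Site d} (hz : z ∈ c.lamS c.k) (hx : Under L c.k z x) : x ∈ c.sq c.k := by
  rw [mem_lamS_top_iff] at hz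
  exact c.mem_sq_top_of_inTop hL hz.1 hz.2 hx

end CubeB8D

/-- **A PURE CUBE OF [6] OVER A BLOCK-SATURATED FAMILY IS A DENTED DATUM** (forget «□ ⊂ Ω_k»): its dented top is `□_k ∩ Ω_k` — for the pure datum too print
only has «□_k ⊂ Ω_{k−1}, □_j ⊂ Ω_j, j < k» (p. 99), not `□_k ⊂ Ω_k`. [cite: Balaban1985RegularSpaces, p.99 («□_k ⊂ Ω_{k−1}, □_j ⊂ Ω_j, j < k»); Balaban1985Variational, p.300] -/
def CubeB8.toDented {d L K : ℕ} {Ω : ℕ → Set (B7Prop1Explicit.Site d)} (c : CubeB8 d L K Ω)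
    (h : ∀ ⦃x y : B7Prop1Explicit.Site d⦄, blockMap (L ^ c.k) x = blockMap (L ^ c.k) y → x ∈ Ω c.k → y ∈ Ω c.k) : CubeB8D d L K Ω :=
  ⟨c.k, c.a, c.M, c.ρ, c.one_le_k, c.k_le, c.L_le_ρ, c.ρ_le_M, c.big, c.L_le_dM, c.tcube_sub, h⟩

/-- `toDented` keeps the scale index (bookkeeping). [cite: Balaban1985RegularSpaces, p.98 («an index j indicating a scale»)] -/
theorem CubeB8.toDented_k {d L K : ℕ} {Ω : ℕ → Set (B7Prop1Explicit.Site d)} (c : CubeB8 d L K Ω)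
    (h : ∀ ⦃x y : B7Prop1Explicit.Site d⦄, blockMap (L ^ c.k) x = blockMap (L ^ c.k) y → x ∈ Ω c.k → y ∈ Ω c.k) : (c.toDented h).k = c.k := rfl

/-- `toDented` keeps the corner (bookkeeping). [cite: Balaban1985RegularSpaces, p.98] -/
theorem CubeB8.toDented_a {d L K : ℕ} {Ω : ℕ → Set (B7Prop1Explicit.Site d)} (c : CubeB8 d L K Ω)
    (h : ∀ ⦃x y : B7Prop1Explicit.Site d⦄, blockMap (L ^ c.k) x = blockMap (L ^ c.k) y → x ∈ Ω c.k → y ∈ Ω c.k) : (c.toDented h).a = c.a := rfl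

/-- `toDented` keeps the side (bookkeeping). [cite: Balaban1985RegularSpaces, p.98 («a size of □ equal to MLʲη»)] -/
theorem CubeB8.toDented_M {d L K : ℕ} {Ω : ℕ → Set (B7Prop1Explicit.Site d)} (c : CubeB8 d L K Ω)
    (h : ∀ ⦃x y : B7Prop1Explicit.Site d⦄, blockMap (L ^ c.k) x = blockMap (L ^ c.k) y → x ∈ Ω c.k → y ∈ Ω c.k) : (c.toDented h).M = c.M := rfl

/-- `toDented` keeps the collar width (bookkeeping). [cite: Balaban1985RegularSpaces, p.98; Balaban1985Variational, (144) p.300] -/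
theorem CubeB8.toDented_ρ {d L K : ℕ} {Ω : ℕ → Set (B7Prop1Explicit.Site d)} (c : CubeB8 d L K Ω)
    (h : ∀ ⦃x y : B7Prop1Explicit.Site d⦄, blockMap (L ^ c.k) x = blockMap (L ^ c.k) y → x ∈ Ω c.k → y ∈ Ω c.k) : (c.toDented h).ρ = c.ρ := rfl

/-- For a pure cube with «□ ⊂ Ω_k» the cube itself lies in the dented top: `□ ⊆ Ω′_k`. [cite: Balaban1985RegularSpaces, p.98 («the cube □ is contained in Ω_j»)] -/
theorem CubeB8.box_subset_sq_toDented {d L K : ℕ} {Ω : ℕ → Set (B7Prop1Explicit.Site d)} (c : CubeB8 d L K Ω)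
    (h : ∀ ⦃x y : B7Prop1Explicit.Site d⦄, blockMap (L ^ c.k) x = blockMap (L ^ c.k) y → x ∈ Ω c.k → y ∈ Ω c.k) :
    box L c.a c.M c.k ⊆ (c.toDented h).sq c.k := by
  intro x hx
  show x ∈ (c.toDented h).sq (c.toDented h).k
  rw [CubeB8D.sq_top]
  exact ⟨box_subset_cube_top L c.a c.M c.ρ c.k hx, c.box_sub hx⟩

end Cube

/-! ## §2. `GaugedBoundB8D U₀ □ r` = (1.135)–(1.138) ∕ (152)–(153) with the number `r`, read on the dented tower -/

section Gauged

variable {d : ℕ} {𝔸 : Type*} [CStarAlgebra 𝔸]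

/-- **(1.135)–(1.138) OF [6] PROPOSITION 6 ∕ (152)–(153) OF [15] WITH THE NUMBER `r`, ON THE DENTED TOWER** — `GaugedBoundB8`'s twelve clauses VERBATIM with the
dented tower `c.sq` and the dented cells `c.lamS`: «there exists a gauge transformation u defined on □̃» — unitary, `= 1` off `□₀`, (1.29) «ū_j = 1 on Λ′_j» for
the DENTED cells — the Landau gauge of record (1.138)∕(153) `R ∂^{η*}A = 0`, «R defined for the sequence {Ω′_j}», for `U₁ = U₀″^{u⁻¹}` at background `1`, the
exponential form with `A` Hermitian and «Lʲη|A| ≤ r» on the sides touching `Ω′_j` ((1.136)₁ ∕ (152)₁ with print's level weights), `w = v⁻¹u` unitary with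
`U₀^{w⁻¹} = U₁` on `□̃`, «(Lʲη)²|∇^η A|, (Lʲη)³|∂^{η*}∂^η A|, (Lʲη)³|Δ^η A| ≤ r on Ω′_j» in the scaled sup norms of record, and (1.137)'s identity
`Q_k(ηA) = log Ū₀′ᵏ` on the bonds of `□^{(k)}` over `Ω_k`.
[cite: Balaban1985RegularSpaces, Prop. 6 (1.135)–(1.138) p.99, (1.29) p.81; Balaban1985Variational, (152)–(153) p.301 («ū_j = 1 on Λ′_j», «R is defined for the sequence {Ω′_j}»)] -/
def GaugedBoundB8D (L : ℕ) {K : ℕ} {Ω : ℕ → Set (B7Prop1Explicit.Site d)} (η : ℝ) (U₀ : B7Prop1Explicit.Site d → Fin d → 𝔸ˣ) (c : CubeB8D d L K Ω) (r : ℝ) : Prop :=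
  ∃ u : B7Prop1Explicit.Site d → 𝔸ˣ, (∀ x, u x ∈ unitaryUnits 𝔸) ∧ (∀ x, x ∉ c.sq 0 → u x = 1) ∧
    Restr129 L c.k c.lamS (1 : B7Prop1Explicit.Site d → Fin d → 𝔸ˣ) u ∧
    IsLandau138W L c.k η (c.sq 0) c.lamS (1 : B7Prop1Explicit.Site d → Fin d → 𝔸ˣ) (c.fixed U₀ u) ∧
    (∀ j, j ≤ c.k → ∀ b ∈ {b : B7Prop1Explicit.Site d × Fin d | SideTouches (c.sq j) b.1 b.2},
      c.fixed U₀ u b.1 b.2 = cfgExp η (logCfg η (c.fixed U₀ u)) b.1 b.2 ∧ IsSelfAdjoint (logCfg η (c.fixed U₀ u) b.1 b.2) ∧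
        ‖logCfg η (c.fixed U₀ u) b.1 b.2‖ ≤ r * ((L : ℝ) ^ j * η)⁻¹) ∧
    (∀ x, ((c.vfix U₀)⁻¹ * u) x ∈ unitaryUnits 𝔸) ∧
    AgreeOn (tlo L (tLo c.a c.ρ) c.k) (thi L (tHi c.a c.M c.ρ) c.k) (gaugeAct ((c.vfix U₀)⁻¹ * u)⁻¹ U₀) (c.fixed U₀ u) ∧
    msup L c.k η (-(2 : ℝ)) (fun j (t : Fin d × Fin d × B7Prop1Explicit.Site d) => SideTouches (c.sq j) t.2.2 t.2.1)
        (fun t => covDerivFwd η (1 : B7Prop1Explicit.Site d → Fin d → 𝔸ˣ) t.1 (fun z => c.expo η U₀ u z t.2.1) t.2.2) ≤ r ∧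
    bondNorm L c.k η (-(3 : ℝ)) c.sq
        (fun x μ => pdiv η (1 : B7Prop1Explicit.Site d → Fin d → 𝔸ˣ) (plaqCovDeriv η (1 : B7Prop1Explicit.Site d → Fin d → 𝔸ˣ) (c.expo η U₀ u)) μ x) ≤ r ∧
    bondNorm L c.k η (-(3 : ℝ)) c.sq (fun x μ => covLap η (1 : B7Prop1Explicit.Site d → Fin d → 𝔸ˣ) (fun z => c.expo η U₀ u z μ) x) ≤ r ∧
    (∀ (x : B7Prop1Explicit.Site d) (μ : Fin d), bLo L c.a 0 0 ≤ x → x + e μ ≤ bHi L c.a c.M 0 0 → c.inTop x → c.inTop (x + e μ) →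
      logCovIter L (1 : B7Prop1Explicit.Site d → Fin d → 𝔸ˣ) (iEta η (c.expo η U₀ u)) c.k x μ = mlog ((avgIter L (c.axial U₀) c.k x μ : 𝔸ˣ) : 𝔸))

/-- **KERNEL COHERENCE** (bookkeeping): the twelve clauses in RAW letters (`cubeFam false … ∩ {j = k → · ∈ Ω_k}`, `CubeB8D.lamS`, `cutFixed`, `localGauge`) assemble to
`GaugedBoundB8D L η U₀ c r` (anonymous constructor; the abbreviations unfold by `rfl`). [cite: Balaban1985RegularSpaces, Prop. 6 (1.135)–(1.138) p.99; Balaban1985Variational, (152)–(153) p.301] -/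
theorem gaugedBoundB8D_intro (L : ℕ) {K : ℕ} {Ω : ℕ → Set (B7Prop1Explicit.Site d)} (η : ℝ) (U₀ : B7Prop1Explicit.Site d → Fin d → 𝔸ˣ)
    (c : CubeB8D d L K Ω) (r : ℝ) (u : B7Prop1Explicit.Site d → 𝔸ˣ) (hu : ∀ x, u x ∈ unitaryUnits 𝔸)
    (huS : ∀ x, x ∉ c.sq 0 → u x = 1)
    (h129 : Restr129 L c.k c.lamS (1 : B7Prop1Explicit.Site d → Fin d → 𝔸ˣ) u)
    (h138 : IsLandau138W L c.k η (c.sq 0) c.lamS (1 : B7Prop1Explicit.Site d → Fin d → 𝔸ˣ)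
      (gaugeAct u⁻¹ (cutFixed L (tLo c.a c.ρ) (tHi c.a c.M c.ρ) U₀ c.k (ctr c.a c.M))))
    (h162 : ∀ j, j ≤ c.k → ∀ b ∈ {b : B7Prop1Explicit.Site d × Fin d | SideTouches (c.sq j) b.1 b.2},
      gaugeAct u⁻¹ (cutFixed L (tLo c.a c.ρ) (tHi c.a c.M c.ρ) U₀ c.k (ctr c.a c.M)) b.1 b.2 =
          cfgExp η (logCfg η (gaugeAct u⁻¹ (cutFixed L (tLo c.a c.ρ) (tHi c.a c.M c.ρ) U₀ c.k (ctr c.a c.M)))) b.1 b.2 ∧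
        IsSelfAdjoint (logCfg η (gaugeAct u⁻¹ (cutFixed L (tLo c.a c.ρ) (tHi c.a c.M c.ρ) U₀ c.k (ctr c.a c.M))) b.1 b.2) ∧
        ‖logCfg η (gaugeAct u⁻¹ (cutFixed L (tLo c.a c.ρ) (tHi c.a c.M c.ρ) U₀ c.k (ctr c.a c.M))) b.1 b.2‖ ≤ r * ((L : ℝ) ^ j * η)⁻¹)
    (hw : ∀ x, ((localGauge L (tLo c.a c.ρ) (tHi c.a c.M c.ρ) U₀ c.k (ctr c.a c.M))⁻¹ * u) x ∈ unitaryUnits 𝔸)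
    (h135 : AgreeOn (tlo L (tLo c.a c.ρ) c.k) (thi L (tHi c.a c.M c.ρ) c.k)
      (gaugeAct ((localGauge L (tLo c.a c.ρ) (tHi c.a c.M c.ρ) U₀ c.k (ctr c.a c.M))⁻¹ * u)⁻¹ U₀)
      (gaugeAct u⁻¹ (cutFixed L (tLo c.a c.ρ) (tHi c.a c.M c.ρ) U₀ c.k (ctr c.a c.M))))
    (h136₂ : msup L c.k η (-(2 : ℝ)) (fun j (t : Fin d × Fin d × B7Prop1Explicit.Site d) => SideTouches (c.sq j) t.2.2 t.2.1)
      (fun t => covDerivFwd η (1 : B7Prop1Explicit.Site d → Fin d → 𝔸ˣ) t.1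
        (fun z => mlogCfg c.k η c.sq (gaugeAct u⁻¹ (cutFixed L (tLo c.a c.ρ) (tHi c.a c.M c.ρ) U₀ c.k (ctr c.a c.M))) z t.2.1) t.2.2) ≤ r)
    (h136₃ : bondNorm L c.k η (-(3 : ℝ)) c.sq
      (fun x μ => pdiv η (1 : B7Prop1Explicit.Site d → Fin d → 𝔸ˣ) (plaqCovDeriv η (1 : B7Prop1Explicit.Site d → Fin d → 𝔸ˣ)
        (mlogCfg c.k η c.sq (gaugeAct u⁻¹ (cutFixed L (tLo c.a c.ρ) (tHi c.a c.M c.ρ) U₀ c.k (ctr c.a c.M))))) μ x) ≤ r)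
    (h136₄ : bondNorm L c.k η (-(3 : ℝ)) c.sq
      (fun x μ => covLap η (1 : B7Prop1Explicit.Site d → Fin d → 𝔸ˣ)
        (fun z => mlogCfg c.k η c.sq (gaugeAct u⁻¹ (cutFixed L (tLo c.a c.ρ) (tHi c.a c.M c.ρ) U₀ c.k (ctr c.a c.M))) z μ) x) ≤ r)
    (h137 : ∀ (x : B7Prop1Explicit.Site d) (μ : Fin d), bLo L c.a 0 0 ≤ x → x + e μ ≤ bHi L c.a c.M 0 0 → c.inTop x → c.inTop (x + e μ) →
      logCovIter L (1 : B7Prop1Explicit.Site d → Fin d → 𝔸ˣ)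
          (iEta η (mlogCfg c.k η c.sq (gaugeAct u⁻¹ (cutFixed L (tLo c.a c.ρ) (tHi c.a c.M c.ρ) U₀ c.k (ctr c.a c.M))))) c.k x μ =
        mlog ((avgIter L (gaugeAct (localGauge L (tLo c.a c.ρ) (tHi c.a c.M c.ρ) U₀ c.k (ctr c.a c.M)) U₀) c.k x μ : 𝔸ˣ) : 𝔸)) :
    GaugedBoundB8D L η U₀ c r :=
  ⟨u, hu, huS, h129, h138, h162, hw, h135, h136₂, h136₃, h136₄, h137⟩

/-- … and conversely `GaugedBoundB8D` hands back the gauge transformation with the eleven clauses (bookkeeping, `Iff.rfl`).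
[cite: Balaban1985RegularSpaces, Prop. 6 (1.135)–(1.138) p.99; Balaban1985Variational, (152)–(153) p.301] -/
theorem gaugedBoundB8D_iff (L : ℕ) {K : ℕ} {Ω : ℕ → Set (B7Prop1Explicit.Site d)} (η : ℝ) (U₀ : B7Prop1Explicit.Site d → Fin d → 𝔸ˣ)
    (c : CubeB8D d L K Ω) (r : ℝ) :
    GaugedBoundB8D L η U₀ c r ↔ ∃ u : B7Prop1Explicit.Site d → 𝔸ˣ, (∀ x, u x ∈ unitaryUnits 𝔸) ∧ (∀ x, x ∉ c.sq 0 → u x = 1) ∧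
      Restr129 L c.k c.lamS (1 : B7Prop1Explicit.Site d → Fin d → 𝔸ˣ) u ∧
      IsLandau138W L c.k η (c.sq 0) c.lamS (1 : B7Prop1Explicit.Site d → Fin d → 𝔸ˣ) (c.fixed U₀ u) ∧
      (∀ j, j ≤ c.k → ∀ b ∈ {b : B7Prop1Explicit.Site d × Fin d | SideTouches (c.sq j) b.1 b.2},
        c.fixed U₀ u b.1 b.2 = cfgExp η (logCfg η (c.fixed U₀ u)) b.1 b.2 ∧ IsSelfAdjoint (logCfg η (c.fixed U₀ u) b.1 b.2) ∧
          ‖logCfg η (c.fixed U₀ u) b.1 b.2‖ ≤ r * ((L : ℝ) ^ j * η)⁻¹) ∧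
      (∀ x, ((c.vfix U₀)⁻¹ * u) x ∈ unitaryUnits 𝔸) ∧
      AgreeOn (tlo L (tLo c.a c.ρ) c.k) (thi L (tHi c.a c.M c.ρ) c.k) (gaugeAct ((c.vfix U₀)⁻¹ * u)⁻¹ U₀) (c.fixed U₀ u) ∧
      msup L c.k η (-(2 : ℝ)) (fun j (t : Fin d × Fin d × B7Prop1Explicit.Site d) => SideTouches (c.sq j) t.2.2 t.2.1)
          (fun t => covDerivFwd η (1 : B7Prop1Explicit.Site d → Fin d → 𝔸ˣ) t.1 (fun z => c.expo η U₀ u z t.2.1) t.2.2) ≤ r ∧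
      bondNorm L c.k η (-(3 : ℝ)) c.sq
          (fun x μ => pdiv η (1 : B7Prop1Explicit.Site d → Fin d → 𝔸ˣ) (plaqCovDeriv η (1 : B7Prop1Explicit.Site d → Fin d → 𝔸ˣ) (c.expo η U₀ u)) μ x) ≤ r ∧
      bondNorm L c.k η (-(3 : ℝ)) c.sq (fun x μ => covLap η (1 : B7Prop1Explicit.Site d → Fin d → 𝔸ˣ) (fun z => c.expo η U₀ u z μ) x) ≤ r ∧
      (∀ (x : B7Prop1Explicit.Site d) (μ : Fin d), bLo L c.a 0 0 ≤ x → x + e μ ≤ bHi L c.a c.M 0 0 → c.inTop x → c.inTop (x + e μ) →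
        logCovIter L (1 : B7Prop1Explicit.Site d → Fin d → 𝔸ˣ) (iEta η (c.expo η U₀ u)) c.k x μ = mlog ((avgIter L (c.axial U₀) c.k x μ : 𝔸ˣ) : 𝔸)) :=
  Iff.rfl

/-- The gauge of `GaugedBoundB8D` satisfies (1.29) for the DENTED cells — the conjunct the N07 road reads (print p. 301 «ū_j = 1 on Λ′_j»). [cite: Balaban1985Variational, (152) p.301; Balaban1985RegularSpaces, (1.29) p.81] -/
theorem GaugedBoundB8D.exists_restr129 {L K : ℕ} {Ω : ℕ → Set (B7Prop1Explicit.Site d)} {η : ℝ} {U₀ : B7Prop1Explicit.Site d → Fin d → 𝔸ˣ} {c : CubeB8D d L K Ω}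
    {r : ℝ} (h : GaugedBoundB8D L η U₀ c r) :
    ∃ u : B7Prop1Explicit.Site d → 𝔸ˣ, (∀ x, u x ∈ unitaryUnits 𝔸) ∧ (∀ x, x ∉ c.sq 0 → u x = 1) ∧
      Restr129 L c.k c.lamS (1 : B7Prop1Explicit.Site d → Fin d → 𝔸ˣ) u ∧
      IsLandau138W L c.k η (c.sq 0) c.lamS (1 : B7Prop1Explicit.Site d → Fin d → 𝔸ˣ) (c.fixed U₀ u) := by
  obtain ⟨u, hu, huS, h129, h138, -⟩ := h
  exact ⟨u, hu, huS, h129, h138⟩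

/-- At a dented cube `c`, the ambient hypothesis `U₀ ∈ 𝔄_K({Ω_j}, α₀)` gives `U₀ ∈ 𝔄_{c.k}({Ω_j}, α₀)` (`c.k_le`; print's «drop the domains Ω_{j′}, j′ > j»).
[cite: Balaban1985RegularSpaces, p.98; Balaban1985Variational, p.300 («intersecting Ω_j but not Ω_{j+1}»)] -/
theorem CubeB8D.inAk {𝔹 : Type*} [NormedRing 𝔹] [NormedAlgebra ℂ 𝔹] {L K : ℕ} {Ω : ℕ → Set (B7Prop1Explicit.Site d)} (c : CubeB8D d L K Ω) {η α : ℝ}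
    {V : B7Prop1Explicit.Site d → Fin d → 𝔹ˣ} (h : InAk L K η α Ω V) : InAk L c.k η α Ω V :=
  inAk_of_le c.k_le h

end Gauged

/-! ## §3. Non-vacuity -/

section NonVacuity

variable {d : ℕ}

/-- In an ambient family with `Ω_k = Ω_{k−1} = T` every cube datum with print's size laws is a dented datum (the block law and «□̃ ⊂ Ω_{k−1}» are automatic; the
dent is empty). [cite: Balaban1985RegularSpaces, p.98; Balaban1985Variational, p.300] -/
def CubeB8D.ofUniv {L K : ℕ} {Ω : ℕ → Set (B7Prop1Explicit.Site d)} (k : ℕ) (a : B7Prop1Explicit.Site d) (M ρ : ℕ) (hk : 1 ≤ k) (hkK : k ≤ K) (hLρ : L ≤ ρ)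
    (hρM : ρ ≤ M) (hbig : 11 * d < M) (hLdM : L ≤ d * M) (hΩ : Ω k = Set.univ) (hΩ' : Ω (k - 1) = Set.univ) : CubeB8D d L K Ω :=
  ⟨k, a, M, ρ, hk, hkK, hLρ, hρM, hbig, hLdM, by rw [hΩ']; exact Set.subset_univ _, fun _ _ _ _ => by rw [hΩ]; exact Set.mem_univ _⟩

/-- The datum `ofUniv` has the prescribed scale index (bookkeeping). [cite: Balaban1985RegularSpaces, p.98; Balaban1985Variational, p.300] -/
theorem CubeB8D.ofUniv_k {L K : ℕ} {Ω : ℕ → Set (B7Prop1Explicit.Site d)} (k : ℕ) (a : B7Prop1Explicit.Site d) (M ρ : ℕ) (hk : 1 ≤ k) (hkK : k ≤ K)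
    (hLρ : L ≤ ρ) (hρM : ρ ≤ M) (hbig : 11 * d < M) (hLdM : L ≤ d * M) (hΩ : Ω k = Set.univ) (hΩ' : Ω (k - 1) = Set.univ) :
    (CubeB8D.ofUniv k a M ρ hk hkK hLρ hρM hbig hLdM hΩ hΩ').k = k := rfl

/-- **THE DENTED CUBE TYPE IS INHABITED** over any ambient family with `Ω_K = Ω_{K−1} = T`, `K ≥ 1`, `d ≥ 1`: scale `K`, corner `0`, `ρ := L`, side `max L (11d + 1)`.
[cite: Balaban1985Variational, p.300; Balaban1985RegularSpaces, p.98] -/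
theorem CubeB8D.nonempty_of_univ {L K : ℕ} {Ω : ℕ → Set (B7Prop1Explicit.Site d)} (hd : 1 ≤ d) (hK : 1 ≤ K) (hΩ : Ω K = Set.univ)
    (hΩ' : Ω (K - 1) = Set.univ) : Nonempty (CubeB8D d L K Ω) :=
  ⟨CubeB8D.ofUniv K 0 (max L (11 * d + 1)) L hK le_rfl le_rfl (le_max_left _ _) (Nat.lt_of_lt_of_le (Nat.lt_succ_self _) (le_max_right _ _))
    ((le_max_left _ _).trans (le_mul_of_one_le_left (Nat.zero_le _) hd)) hΩ hΩ'⟩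

/-- Every `CubeB8` cube over a `BigCubes14`∕block-saturated ambient family yields a dented datum, so the dented type is inhabited wherever the pure one is and
`Ω_k` is a union of `k`-blocks. [cite: Balaban1985RegularSpaces, (1.3)–(1.4) p.77, p.98] -/
theorem CubeB8D.nonempty_of_cubeB8 {L K : ℕ} {Ω : ℕ → Set (B7Prop1Explicit.Site d)} (c : CubeB8 d L K Ω)
    (h : ∀ ⦃x y : B7Prop1Explicit.Site d⦄, blockMap (L ^ c.k) x = blockMap (L ^ c.k) y → x ∈ Ω c.k → y ∈ Ω c.k) : Nonempty (CubeB8D d L K Ω) :=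
  ⟨c.toDented h⟩

end NonVacuity

end Literature.MathematicalPhysics.QuantumFieldTheory.Balaban1983to89.Node00

end
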